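import Literature.AnabelianGeometry.EtaleTheta.TemperedFrobenioidOfRankOneObjectR
import Literature.AnabelianGeometry.EtaleTheta.Discharge.Sec3Cor38OfTower
import Literature.AnabelianGeometry.EtaleTheta.Discharge.Sec3Cor38OfGaloisCoveringConnectedR
import HarnessLib

/-!
# [EtTh] Corollary 3.8 (i) ∧ (ii) ∧ (iii) AS TYPED, monoid type `Λ = ℝ`, over Def. 3.3 (iii) v2 data `DivisorMonoids.ofTower T`, and with
# NO binder at the v2 MODEL OF RECORD (Kummer–Tate tower, `TateTowerKummer.temperedFrobenioidR`)

S. Mochizuki, *The étale theta function and its Frobenioid-theoretic manifestations*, Publ. RIMS **45** (2009), Cor. 3.8, PDF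
pp. 80–81 [cite: MochizukiEtTh2009, Cor 3.8 p.80]; Def. 3.6 (i) p.76 (`Λ = ℝ`: `B₀^ℝ := ℝ·Φ₀^birat`, `F₀^ℝ := ℝ·Φ₀^cnst`), Prop. 3.4 (ii) p.74.

abc-iut cell, layer L2, seat abc-iut-L2-d2 (gen 5); last item of the v2 chain (memo `VNEXT-V2-RealifiedChain-L2d2.md` §3).  PROOF-ONLY;
the `Λ = ℝ` twin of `Sec3Cor38OfTower.lean` (p467146), i.e. p450744 / p462065 re-keyed from `ofGaloisActionConnected A hZ` to
abc-iut-L2-t3's `ofTower T` and from abc-iut-w6-d048's `ofRankOnePointR` to the `dm`-generic `ofRankOneObjectR` (p467678):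

* §1 inputs for ANY tower `T`: `hP34Λ_ofTower_weakR (hE)` (⟸ the `Λ = ℝ` effective-locus clause), `ratSupport_of_eq_mrange_ofTowerR`,
  `hQ_of_eq_mrange_ofTowerR` (⟸ Φ-tie; abc-iut-L6-t12's `isQMonoprime_pfAt_divisorMonoid_of_ratSupport_weak`, (hZQ) per level p467146);
* §2 `Cor38Hyp.cor38_i_ofTowerR_of_isFrobenioid_of_eq_mrange` / `cor38_ii_…` — Cor. 3.8 (i), (ii) AS TYPED, `Λ = ℝ`, two towers, any
  category vocabularies; residual {`IsFrobenioid`, `hE`, Φ-ties, `Prop34Const`} (`hFinv` unconditional: `ofRlfRWeak_hFinv'`);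
* §3 rank-one OBJECTS, `Λ = ℝ`: `ofRankOneObjectR_Φ_eq_mrange` (rfl), `ofRankOneObjectR_nonDilating`, `nonempty_cor38Hyp_ofRankOneObjectR`,
  `countable_primes_perfection_Φ_ofRankOneObjectR`, `cor38_i_ii_ofRankOneObjectR_ofTower (h) (hE hE') (hC hC')`;
* §4 the v2 MODEL OF RECORD: **`TateTowerKummer.cor38_temperedFrobenioidR (h) : Cor38_i ∧ Cor38_ii ∧ Cor38_iii h`, NO BINDER**
  (`hE := effRealSpan_ofTower` p465055, `Prop34Const := prop34Const_ofTower` p466252, (iii) = this seat's `Λ = ℝ` apex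
  `cor38_iii_ofRlfRWeak_of_isFrobenioid_of_countable_of_prop34Const`), its conclusions, ∃-form, and `hull_selfEquivalence_temperedFrobenioidR`.

HONEST LABEL: instantiation / consistency certificates over the GENUINE weak vocabularies at CONSTRUCTED data (`D` one object at §3–§4);
refereed pre-IUT material; nothing here bears on [IUTchIII] Cor. 3.12; no side taken; typed ≠ proved — here proved.
-/

noncomputable section

namespace Literature.AnabelianGeometry.EtaleTheta

open CategoryTheory Opposite Function Literature.AlgebraicGeometry.Frobenioids Literature.AnabelianGeometry.SemiGraphs
  LogDivisorModel LogDivisorModel.GaloisAction LogDivisorTower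

universe u u' v'

/-! ## §1 The `Λ = ℝ` inputs at `ofRlfRWeak (ofTower T) hpf` -/

namespace TemperedFrobenioid

section InputsTowerR

variable {P : Type u} [Group P] [TopologicalSpace P] {L : LevelSystem P} (T : LogDivisorTower P L)
  (hpf : ∀ Y : (ConnectedPart (BTemp P))ᵒᵖ, IsPerfFactorialCof ((DivisorMonoids.ofTower T).Φ₀.obj Y))

/-- **`hP34Λ` at monoid type `ℝ` over a v2 tower ⟸ the `Λ = ℝ` effective-locus clause `hE`** (Prop. 3.4 (ii) clause 1 for
`B₀^ℝ = ℝ·Φ₀^birat`, `F₀^ℝ = ℝ·Φ₀^cnst`). [cite: MochizukiEtTh2009, Prop 3.4 (ii) p.74] -/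
theorem hP34Λ_ofTower_weakR
    (hE : ∀ (Y : ConnectedPart (BTemp P))
      (b : Algebra.GrothendieckGroup ((RealifiedDivisorMonoids.realDataWeak (DivisorMonoids.ofTower T) hpf).rlf.obj (op Y)))
      (x : (hpf (op Y)).weak.Rlf),
      b ∈ ((RealifiedDivisorMonoids.realDataWeak (DivisorMonoids.ofTower T) hpf).realSpan (DivisorMonoids.ofTower T).biratGp).carrier Y →
        b = Algebra.GrothendieckGroup.of x →
        b ∈ ((RealifiedDivisorMonoids.realDataWeak (DivisorMonoids.ofTower T) hpf).realSpan (DivisorMonoids.ofTower T).cnstGp).carrier Y)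
    (Y : (ConnectedPart (BTemp P))ᵒᵖ) (b : (RealifiedDivisorMonoids.ofRlfRWeak (DivisorMonoids.ofTower T) hpf).BΛ.obj Y)
    (r : (RealifiedDivisorMonoids.ofRlfRWeak (DivisorMonoids.ofTower T) hpf).ΦR.obj Y)
    (h : (RealifiedDivisorMonoids.ofRlfRWeak (DivisorMonoids.ofTower T) hpf).divΛ Y b = Algebra.GrothendieckGroup.of r) :
    b ∈ (RealifiedDivisorMonoids.ofRlfRWeak (DivisorMonoids.ofTower T) hpf).FΛ Y :=
  hE (unop Y) b.1 r b.2 h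

variable {T hpf} {D : Type u'} [Category.{v'} D] {VD : FrdICatStub.{u', v', u} D}

/-- **(hsat) from the Φ-tie, monoid type `ℝ`, over a v2 tower.** [cite: MochizukiEtTh2009, Ex 3.9 p.84] -/
theorem ratSupport_of_eq_mrange_ofTowerR
    (CR : TemperedFrobenioid (RealifiedDivisorMonoids.ofRlfRWeak (DivisorMonoids.ofTower T) hpf) D VD)
    (hΦ : ∀ B : Dᵒᵖ, CR.Φ.carrier B = MonoidHom.mrange (hpf (CR.baseOp B)).weak.toRealification) (W : D) :
    ∀ x ∈ CR.Φ.carrier (op W),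
      ∃ (N : ℕ+) (d : (DivisorMonoids.ofTower T).Φ₀.obj (CR.baseOp (op W))),
        x ^ (N : ℕ) = (RealifiedDivisorMonoids.ofRlfRWeak (DivisorMonoids.ofTower T) hpf).toR (CR.baseOp (op W)) d := by
  intro x hx
  rw [hΦ] at hx
  obtain ⟨a, rfl⟩ := hx
  obtain ⟨⟨c, n⟩, rfl⟩ := Perfection.mk_surjective a
  refine ⟨n, c, ?_⟩
  change (hpf _).weak.toRealification (Perfection.mk c n) ^ (n : ℕ) = (hpf _).weak.toRealification (Perfection.of _ c)
  rw [← map_pow, Perfection.mk_pow_self]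

/-- **`hQ`, monoid type `ℝ`, is a THEOREM for every tempered Frobenioid with print's `Φ` over a v2 tower** ((hZQ) per level,
(hsat) from the Φ-tie). [cite: MochizukiEtTh2009, Def 3.6 p.77] -/
theorem hQ_of_eq_mrange_ofTowerR
    (CR : TemperedFrobenioid (RealifiedDivisorMonoids.ofRlfRWeak (DivisorMonoids.ofTower T) hpf) D VD)
    (hΦ : ∀ B : Dᵒᵖ, CR.Φ.carrier B = MonoidHom.mrange (hpf (CR.baseOp B)).weak.toRealification) (W : D)
    (𝔮 : Primes (Perfection (CR.divisorMonoid.obj (op W)))) : IsQMonoprime (PfAt (CR.divisorMonoid.obj (op W)) 𝔮) :=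
  isQMonoprime_pfAt_divisorMonoid_of_ratSupport_weak W (fun 𝔭 => isZQMonoprime_primes_Φ₀_ofTower T _ 𝔭)
    (CR.ratSupport_of_eq_mrange_ofTowerR hΦ W) 𝔮

end InputsTowerR

end TemperedFrobenioid

/-! ## §2 Cor. 3.8 (i), (ii), `Λ = ℝ`, over two towers, any category vocabularies -/

namespace Cor38Hyp

section TowerR

variable {P : Type u} [Group P] [TopologicalSpace P] {L : LevelSystem P} {T : LogDivisorTower P L}
  {hpf : ∀ Y : (ConnectedPart (BTemp P))ᵒᵖ, IsPerfFactorialCof ((DivisorMonoids.ofTower T).Φ₀.obj Y)}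
  {P' : Type u} [Group P'] [TopologicalSpace P'] {L' : LevelSystem P'} {T' : LogDivisorTower P' L'}
  {hpf' : ∀ Y : (ConnectedPart (BTemp P'))ᵒᵖ, IsPerfFactorialCof ((DivisorMonoids.ofTower T').Φ₀.obj Y)}
  {D : Type u'} [Category.{v'} D] {VD : FrdICatStub.{u', v', u} D}
  {D' : Type u'} [Category.{v'} D'] {VD' : FrdICatStub.{u', v', u} D'}
  {C₁ : TemperedFrobenioid (RealifiedDivisorMonoids.ofRlfRWeak (DivisorMonoids.ofTower T) hpf) D VD}
  {C₂ : TemperedFrobenioid (RealifiedDivisorMonoids.ofRlfRWeak (DivisorMonoids.ofTower T') hpf') D' VD'}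

/-- **[EtTh] Cor. 3.8 (i) AS TYPED, `Λ = ℝ`, for tempered Frobenioids with print's `Φ` over two v2 towers**, residual {`hF_i`, `hE_i`,
Φ-ties, `Prop34Const_i`}. [cite: MochizukiEtTh2009, Cor 3.8 p.80] -/
theorem cor38_i_ofTowerR_of_isFrobenioid_of_eq_mrange (h : Cor38Hyp C₁ C₂)
    (hF₁ : PreFrobenioid.IsFrobenioid C₁.toElem) (hF₂ : PreFrobenioid.IsFrobenioid C₂.toElem)
    (hE₁ : ∀ (Y : ConnectedPart (BTemp P))
      (b : Algebra.GrothendieckGroup ((RealifiedDivisorMonoids.realDataWeak (DivisorMonoids.ofTower T) hpf).rlf.obj (op Y)))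
      (x : (hpf (op Y)).weak.Rlf),
      b ∈ ((RealifiedDivisorMonoids.realDataWeak (DivisorMonoids.ofTower T) hpf).realSpan (DivisorMonoids.ofTower T).biratGp).carrier Y →
        b = Algebra.GrothendieckGroup.of x →
        b ∈ ((RealifiedDivisorMonoids.realDataWeak (DivisorMonoids.ofTower T) hpf).realSpan (DivisorMonoids.ofTower T).cnstGp).carrier Y)
    (hE₂ : ∀ (Y : ConnectedPart (BTemp P'))
      (b : Algebra.GrothendieckGroup ((RealifiedDivisorMonoids.realDataWeak (DivisorMonoids.ofTower T') hpf').rlf.obj (op Y)))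
      (x : (hpf' (op Y)).weak.Rlf),
      b ∈ ((RealifiedDivisorMonoids.realDataWeak (DivisorMonoids.ofTower T') hpf').realSpan (DivisorMonoids.ofTower T').biratGp).carrier Y →
        b = Algebra.GrothendieckGroup.of x →
        b ∈ ((RealifiedDivisorMonoids.realDataWeak (DivisorMonoids.ofTower T') hpf').realSpan (DivisorMonoids.ofTower T').cnstGp).carrier Y)
    (hΦ₁ : ∀ B : Dᵒᵖ, C₁.Φ.carrier B = MonoidHom.mrange (hpf (C₁.baseOp B)).weak.toRealification)
    (hΦ₂ : ∀ B : D'ᵒᵖ, C₂.Φ.carrier B = MonoidHom.mrange (hpf' (C₂.baseOp B)).weak.toRealification)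
    (hC₁ : (DivisorMonoids.ofTower T).Prop34Const) (hC₂ : (DivisorMonoids.ofTower T').Prop34Const) :
    Literature.AnabelianGeometry.EtaleTheta.Cor38_i (fun E _ => Literature.AlgebraicGeometry.Frobenioids.IsFrobeniusSlim E) h :=
  h.cor38_i_weak_of_coord hF₁ hF₂ (TemperedFrobenioid.hP34Λ_ofTower_weakR T hpf hE₁)
    (C₁.exists_cnstFn_effective_ofRlfRWeak_of_prop34Const hC₁) (C₁.hQ_of_eq_mrange_ofTowerR hΦ₁)
    (TemperedFrobenioid.hP34Λ_ofTower_weakR T' hpf' hE₂) (C₂.exists_cnstFn_effective_ofRlfRWeak_of_prop34Const hC₂)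
    (C₂.hQ_of_eq_mrange_ofTowerR hΦ₂)

/-- **[EtTh] Cor. 3.8 (ii) AS TYPED, `Λ = ℝ`, same data and residual** (`hFinv_i` unconditional). [cite: MochizukiEtTh2009, Cor 3.8 p.81] -/
theorem cor38_ii_ofTowerR_of_isFrobenioid_of_eq_mrange (h : Cor38Hyp C₁ C₂)
    (hF₁ : PreFrobenioid.IsFrobenioid C₁.toElem) (hF₂ : PreFrobenioid.IsFrobenioid C₂.toElem)
    (hE₁ : ∀ (Y : ConnectedPart (BTemp P))
      (b : Algebra.GrothendieckGroup ((RealifiedDivisorMonoids.realDataWeak (DivisorMonoids.ofTower T) hpf).rlf.obj (op Y)))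
      (x : (hpf (op Y)).weak.Rlf),
      b ∈ ((RealifiedDivisorMonoids.realDataWeak (DivisorMonoids.ofTower T) hpf).realSpan (DivisorMonoids.ofTower T).biratGp).carrier Y →
        b = Algebra.GrothendieckGroup.of x →
        b ∈ ((RealifiedDivisorMonoids.realDataWeak (DivisorMonoids.ofTower T) hpf).realSpan (DivisorMonoids.ofTower T).cnstGp).carrier Y)
    (hE₂ : ∀ (Y : ConnectedPart (BTemp P'))
      (b : Algebra.GrothendieckGroup ((RealifiedDivisorMonoids.realDataWeak (DivisorMonoids.ofTower T') hpf').rlf.obj (op Y)))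
      (x : (hpf' (op Y)).weak.Rlf),
      b ∈ ((RealifiedDivisorMonoids.realDataWeak (DivisorMonoids.ofTower T') hpf').realSpan (DivisorMonoids.ofTower T').biratGp).carrier Y →
        b = Algebra.GrothendieckGroup.of x →
        b ∈ ((RealifiedDivisorMonoids.realDataWeak (DivisorMonoids.ofTower T') hpf').realSpan (DivisorMonoids.ofTower T').cnstGp).carrier Y)
    (hΦ₁ : ∀ B : Dᵒᵖ, C₁.Φ.carrier B = MonoidHom.mrange (hpf (C₁.baseOp B)).weak.toRealification)
    (hΦ₂ : ∀ B : D'ᵒᵖ, C₂.Φ.carrier B = MonoidHom.mrange (hpf' (C₂.baseOp B)).weak.toRealification)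
    (hC₁ : (DivisorMonoids.ofTower T).Prop34Const) (hC₂ : (DivisorMonoids.ofTower T').Prop34Const) :
    Literature.AnabelianGeometry.EtaleTheta.Cor38_ii
      (fun E _ Φ => ∀ (B : E) (α : Aut (Over.forget B)),
        (∀ (B' : Over B) (x : Φ.obj (op B'.left)),
          Literature.AlgebraicGeometry.Frobenioids.pull Φ (α.hom.app B') x = x) → α = 1) h :=
  h.cor38_ii_weak_of_coord hF₁ hF₂ (TemperedFrobenioid.hP34Λ_ofTower_weakR T hpf hE₁)
    (C₁.exists_cnstFn_effective_ofRlfRWeak_of_prop34Const hC₁) (C₁.hQ_of_eq_mrange_ofTowerR hΦ₁)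
    (RealifiedDivisorMonoids.ofRlfRWeak_hFinv' _ hpf) (TemperedFrobenioid.hP34Λ_ofTower_weakR T' hpf' hE₂)
    (C₂.exists_cnstFn_effective_ofRlfRWeak_of_prop34Const hC₂) (C₂.hQ_of_eq_mrange_ofTowerR hΦ₂)
    (RealifiedDivisorMonoids.ofRlfRWeak_hFinv' _ hpf')

end TowerR

end Cor38Hyp

/-! ## §3 Rank-one OBJECTS of towers, `Λ = ℝ`: residual {`hE`, `Prop34Const`} -/

namespace TemperedFrobenioid

section RankOneObjectTowerR

variable {P : Type} [Group P] [TopologicalSpace P] {L : LevelSystem P} {T : LogDivisorTower P L}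
  (Q : (DivisorMonoids.ofTower T).RankOneObject)
  (hpf : ∀ Y : (ConnectedPart (BTemp P))ᵒᵖ, IsPerfFactorialCof ((DivisorMonoids.ofTower T).Φ₀.obj Y))
  (R S : ((Discrete PUnit.{1})ᵒᵖ ⥤ CommMonCat.{0}) → Prop)
  {P' : Type} [Group P'] [TopologicalSpace P'] {L' : LevelSystem P'} {T' : LogDivisorTower P' L'}
  (Q' : (DivisorMonoids.ofTower T').RankOneObject)
  (hpf' : ∀ Y : (ConnectedPart (BTemp P'))ᵒᵖ, IsPerfFactorialCof ((DivisorMonoids.ofTower T').Φ₀.obj Y))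
  (R' S' : ((Discrete PUnit.{1})ᵒᵖ ⥤ CommMonCat.{0}) → Prop)

/-- **The Φ-tie at a `Λ = ℝ` rank-one object is definitional.** [cite: MochizukiEtTh2009, Def 3.6 p.77] -/
theorem ofRankOneObjectR_Φ_eq_mrange (B : (Discrete PUnit.{1})ᵒᵖ) :
    (ofRankOneObjectR Q hpf R S).Φ.carrier B = MonoidHom.mrange (hpf ((ofRankOneObjectR Q hpf R S).baseOp B)).weak.toRealification :=
  rfl

/-- `Φ` of a `Λ = ℝ` rank-one-object Frobenioid is non-dilating under the endomorphisms of its one-point base.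
[cite: MochizukiEtTh2009, Cor 3.8 p.80] -/
theorem ofRankOneObjectR_nonDilating (B : (Discrete PUnit.{1})ᵒᵖ) (f : B ⟶ B) :
    treeMonoidVocabWeak.IsNonDilating _ ((ofRankOneObjectR Q hpf R S).Φ.pull f) := by
  have hf : f = 𝟙 B := Quiver.Hom.unop_inj (Subsingleton.elim _ _)
  subst hf
  rw [treeMonoidVocabWeak_isNonDilating]
  have hpull : (ofRankOneObjectR Q hpf R S).Φ.pull (𝟙 B) = MonoidHom.id _ := by
    ext x
    rw [SubMonoidOn.coe_pull, CategoryTheory.Functor.map_id, MonoidHom.id_apply]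
    rfl
  rw [hpull]
  exact Example39NV.isNonDilating_id

/-- **The Cor. 3.8 datum is inhabited between two `Λ = ℝ` rank-one-object Frobenioids over the SAME data** (`Ψ := 𝟭`).
[cite: MochizukiEtTh2009, Cor 3.8 p.80] -/
theorem nonempty_cor38Hyp_ofRankOneObjectR :
    Nonempty (Cor38Hyp (ofRankOneObjectR Q hpf R S) (ofRankOneObjectR Q hpf R S)) :=
  ⟨{ Ψ := CategoryTheory.Equivalence.refl
     fsmff := ⟨PadicFrd.isOfFSMType_discretePUnit.isOfFSMFFType, PadicFrd.isOfFSMType_discretePUnit.isOfFSMFFType⟩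
     nonDilating := ⟨ofRankOneObjectR_nonDilating Q hpf R S, ofRankOneObjectR_nonDilating Q hpf R S⟩ }⟩

/-- **`hcnt` at a `Λ = ℝ` rank-one object** (same `Φ` as at `Λ = ℤ`). [cite: MochizukiEtTh2009, Ex 3.9 p.84] -/
theorem countable_primes_perfection_Φ_ofRankOneObjectR [Countable (Primes (Perfection ((DivisorMonoids.ofTower T).Φ₀.obj (op Q.Y₀))))]
    (B : (Discrete PUnit.{1})ᵒᵖ) : Countable (Primes (Perfection ↥((ofRankOneObjectR Q hpf R S).Φ.carrier B))) := by
  have hM := hpf (op Q.Y₀)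
  haveI : Countable (Primes ↥(MonoidHom.mrange hM.weak.toRealification)) :=
    countable_primes_of_mulEquiv (MulEquiv.ofBijective _ (PfImageWeak.mrangeRestrict_toRealification_bijective hM.weak))
  exact (PfImageWeak.isPerfFactorialCof_mrange_toRealification hM).weak.countable_primes_perfection

/-- **[EtTh] Cor. 3.8 (i) ∧ (ii) AS TYPED, `Λ = ℝ`, between two rank-one-object Frobenioids over v2 towers**, residual {`hE`, `Prop34Const`}
of the two data. [cite: MochizukiEtTh2009, Cor 3.8 p.80] -/
theorem cor38_i_ii_ofRankOneObjectR_ofTower (h : Cor38Hyp (ofRankOneObjectR Q hpf R S) (ofRankOneObjectR Q' hpf' R' S'))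
    (hE : ∀ (Y : ConnectedPart (BTemp P))
      (b : Algebra.GrothendieckGroup ((RealifiedDivisorMonoids.realDataWeak (DivisorMonoids.ofTower T) hpf).rlf.obj (op Y)))
      (x : (hpf (op Y)).weak.Rlf),
      b ∈ ((RealifiedDivisorMonoids.realDataWeak (DivisorMonoids.ofTower T) hpf).realSpan (DivisorMonoids.ofTower T).biratGp).carrier Y →
        b = Algebra.GrothendieckGroup.of x →
        b ∈ ((RealifiedDivisorMonoids.realDataWeak (DivisorMonoids.ofTower T) hpf).realSpan (DivisorMonoids.ofTower T).cnstGp).carrier Y)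
    (hE' : ∀ (Y : ConnectedPart (BTemp P'))
      (b : Algebra.GrothendieckGroup ((RealifiedDivisorMonoids.realDataWeak (DivisorMonoids.ofTower T') hpf').rlf.obj (op Y)))
      (x : (hpf' (op Y)).weak.Rlf),
      b ∈ ((RealifiedDivisorMonoids.realDataWeak (DivisorMonoids.ofTower T') hpf').realSpan (DivisorMonoids.ofTower T').biratGp).carrier Y →
        b = Algebra.GrothendieckGroup.of x →
        b ∈ ((RealifiedDivisorMonoids.realDataWeak (DivisorMonoids.ofTower T') hpf').realSpan (DivisorMonoids.ofTower T').cnstGp).carrier Y)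
    (hC : (DivisorMonoids.ofTower T).Prop34Const) (hC' : (DivisorMonoids.ofTower T').Prop34Const) :
    Literature.AnabelianGeometry.EtaleTheta.Cor38_i (fun E _ => Literature.AlgebraicGeometry.Frobenioids.IsFrobeniusSlim E) h ∧
      Literature.AnabelianGeometry.EtaleTheta.Cor38_ii
        (fun E _ Φ => ∀ (B : E) (α : Aut (Over.forget B)),
          (∀ (B' : Over B) (x : Φ.obj (op B'.left)),
            Literature.AlgebraicGeometry.Frobenioids.pull Φ (α.hom.app B') x = x) → α = 1) h :=
  ⟨h.cor38_i_ofTowerR_of_isFrobenioid_of_eq_mrange (isFrobenioid_ofRankOneObjectR Q hpf R S) (isFrobenioid_ofRankOneObjectR Q' hpf' R' S')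
      hE hE' (ofRankOneObjectR_Φ_eq_mrange Q hpf R S) (ofRankOneObjectR_Φ_eq_mrange Q' hpf' R' S') hC hC',
    h.cor38_ii_ofTowerR_of_isFrobenioid_of_eq_mrange (isFrobenioid_ofRankOneObjectR Q hpf R S) (isFrobenioid_ofRankOneObjectR Q' hpf' R' S')
      hE hE' (ofRankOneObjectR_Φ_eq_mrange Q hpf R S) (ofRankOneObjectR_Φ_eq_mrange Q' hpf' R' S') hC hC'⟩

/-- **[EtTh] Cor. 3.8 (ii) for EVERY self-equivalence of a `Λ = ℝ` rank-one-object Frobenioid over a v2 tower**, residual {`hE`,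
`Prop34Const`} (abc-iut-L1-t12's `hull_selfEquivalence_weak_of_coord`). [cite: MochizukiEtTh2009, Cor 3.8 p.81] -/
theorem hull_selfEquivalence_ofRankOneObjectR_ofTower
    (hE : ∀ (Y : ConnectedPart (BTemp P))
      (b : Algebra.GrothendieckGroup ((RealifiedDivisorMonoids.realDataWeak (DivisorMonoids.ofTower T) hpf).rlf.obj (op Y)))
      (x : (hpf (op Y)).weak.Rlf),
      b ∈ ((RealifiedDivisorMonoids.realDataWeak (DivisorMonoids.ofTower T) hpf).realSpan (DivisorMonoids.ofTower T).biratGp).carrier Y →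
        b = Algebra.GrothendieckGroup.of x →
        b ∈ ((RealifiedDivisorMonoids.realDataWeak (DivisorMonoids.ofTower T) hpf).realSpan (DivisorMonoids.ofTower T).cnstGp).carrier Y)
    (hC : (DivisorMonoids.ofTower T).Prop34Const)
    (e : (ofRankOneObjectR Q hpf R S).category ≌ (ofRankOneObjectR Q hpf R S).category) :
    (∀ {X Y : (ofRankOneObjectR Q hpf R S).category} (f : X ⟶ Y),
        (ofRankOneObjectR Q hpf R S).IsBaseFieldTheoretic f ↔ (ofRankOneObjectR Q hpf R S).IsBaseFieldTheoretic (e.functor.map f)) ∧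
      ∃ e' : (ofRankOneObjectR Q hpf R S).hullCategory ≌ (ofRankOneObjectR Q hpf R S).hullCategory,
        Nonempty ((ofRankOneObjectR Q hpf R S).hull ⋙ e.functor ≅ e'.functor ⋙ (ofRankOneObjectR Q hpf R S).hull) :=
  (ofRankOneObjectR Q hpf R S).hull_selfEquivalence_weak_of_coord PadicFrd.isOfFSMType_discretePUnit.isOfFSMFFType
    (ofRankOneObjectR_nonDilating Q hpf R S) (Toy.isDivSlim45iv_discretePUnit _) (isFrobenioid_ofRankOneObjectR Q hpf R S)
    (hP34Λ_ofTower_weakR T hpf hE) ((ofRankOneObjectR Q hpf R S).exists_cnstFn_effective_ofRlfRWeak_of_prop34Const hC)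
    ((ofRankOneObjectR Q hpf R S).hQ_of_eq_mrange_ofTowerR (ofRankOneObjectR_Φ_eq_mrange Q hpf R S))
    (RealifiedDivisorMonoids.ofRlfRWeak_hFinv' _ hpf) e

end RankOneObjectTowerR

end TemperedFrobenioid

/-! ## §4 The v2 MODEL OF RECORD, `Λ = ℝ`: Cor. 3.8 (i) ∧ (ii) ∧ (iii), NO binder -/

namespace TateTowerKummer

variable (R S R' S' : ((Discrete PUnit.{1})ᵒᵖ ⥤ CommMonCat.{0}) → Prop)

/-- `hcnt` at the `Λ = ℝ` v2 model-of-record Frobenioid. [cite: MochizukiEtTh2009, Ex 3.9 p.84] -/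
theorem countable_primes_perfection_Φ_temperedFrobenioidR (B : (Discrete PUnit.{1})ᵒᵖ) :
    Countable (Primes (Perfection ↥((TateTowerKummer.temperedFrobenioidR R S).Φ.carrier B))) := by
  haveI := countable_primes_perfection_Φ₀_ofTower (op rankOneObject.Y₀)
  exact TemperedFrobenioid.countable_primes_perfection_Φ_ofRankOneObjectR rankOneObject hpf R S B

/-- **[EtTh] Cor. 3.8 (i) ∧ (ii) AS TYPED, `Λ = ℝ`, at the v2 MODEL OF RECORD, NO binder beyond `h`** (`hE := effRealSpan_ofTower`,
`Prop34Const := prop34Const_ofTower`). [cite: MochizukiEtTh2009, Cor 3.8 p.80] -/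
theorem cor38_i_ii_temperedFrobenioidR (h : Cor38Hyp (TateTowerKummer.temperedFrobenioidR R S) (TateTowerKummer.temperedFrobenioidR R' S')) :
    Literature.AnabelianGeometry.EtaleTheta.Cor38_i (fun E _ => Literature.AlgebraicGeometry.Frobenioids.IsFrobeniusSlim E) h ∧
      Literature.AnabelianGeometry.EtaleTheta.Cor38_ii
        (fun E _ Φ => ∀ (B : E) (α : Aut (Over.forget B)),
          (∀ (B' : Over B) (x : Φ.obj (op B'.left)),
            Literature.AlgebraicGeometry.Frobenioids.pull Φ (α.hom.app B') x = x) → α = 1) h :=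
  TemperedFrobenioid.cor38_i_ii_ofRankOneObjectR_ofTower rankOneObject hpf R S rankOneObject hpf R' S' h effRealSpan_ofTower
    effRealSpan_ofTower prop34Const_ofTower prop34Const_ofTower

/-- **[EtTh] Cor. 3.8 (i) ∧ (ii) ∧ (iii) AS TYPED, `Λ = ℝ`, at the v2 MODEL OF RECORD, for every `h`, NO binder beyond `h`** ((iii) = this
seat's `Λ = ℝ` apex with `hcnt`, `Prop34Const`, «`C` is a Frobenioid» all theorems here). [cite: MochizukiEtTh2009, Cor 3.8 p.80] -/
theorem cor38_temperedFrobenioidR (h : Cor38Hyp (TateTowerKummer.temperedFrobenioidR R S) (TateTowerKummer.temperedFrobenioidR R' S')) :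
    Literature.AnabelianGeometry.EtaleTheta.Cor38_i (fun E _ => Literature.AlgebraicGeometry.Frobenioids.IsFrobeniusSlim E) h ∧
      Literature.AnabelianGeometry.EtaleTheta.Cor38_ii
        (fun E _ Φ => ∀ (B : E) (α : Aut (Over.forget B)),
          (∀ (B' : Over B) (x : Φ.obj (op B'.left)),
            Literature.AlgebraicGeometry.Frobenioids.pull Φ (α.hom.app B') x = x) → α = 1) h ∧
      Cor38_iii h :=
  ⟨(cor38_i_ii_temperedFrobenioidR R S R' S' h).1, (cor38_i_ii_temperedFrobenioidR R S R' S' h).2,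
    cor38_iii_ofRlfRWeak_of_isFrobenioid_of_countable_of_prop34Const h (countable_primes_perfection_Φ_temperedFrobenioidR R S)
      (countable_primes_perfection_Φ_temperedFrobenioidR R' S') prop34Const_ofTower prop34Const_ofTower
      (isFrobenioid_temperedFrobenioidR R S) (isFrobenioid_temperedFrobenioidR R' S')⟩

/-- **The CONCLUSIONS of Cor. 3.8 (i), (ii) and the first clause of (iii), `Λ = ℝ`, at the v2 model of record, for every `h`.**
[cite: MochizukiEtTh2009, Cor 3.8 p.81] -/
theorem cor38_conclusion_temperedFrobenioidR
    (h : Cor38Hyp (TateTowerKummer.temperedFrobenioidR R S) (TateTowerKummer.temperedFrobenioidR R' S')) :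
    (PreservesBaseFieldTheoretic h ∧
      ∃ Ψbs : (TateTowerKummer.temperedFrobenioidR R S).hullCategory ≌ (TateTowerKummer.temperedFrobenioidR R' S').hullCategory,
        Nonempty ((TateTowerKummer.temperedFrobenioidR R S).hull ⋙ h.Ψ.functor ≅
          Ψbs.functor ⋙ (TateTowerKummer.temperedFrobenioidR R' S').hull)) ∧
      Cor38_iii h :=
  ⟨(cor38_i_ii_temperedFrobenioidR R S R' S' h).2 (Toy.isDivSlim45iv_discretePUnit _) (Toy.isDivSlim45iv_discretePUnit _),
    (cor38_temperedFrobenioidR R S R' S' h).2.2⟩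

/-- **The typed statements of the nodes `EtTh:Cor3.8(i)`, `(ii)`, `(iii)` at `Λ = ℝ` have a SIMULTANEOUS unconditional kernel instance at
the v2 MODEL OF RECORD** (`Ψ := 𝟭`). [cite: MochizukiEtTh2009, Cor 3.8 p.80] -/
theorem exists_cor38Hyp_cor38_temperedFrobenioidR :
    ∃ h : Cor38Hyp (TateTowerKummer.temperedFrobenioidR R S) (TateTowerKummer.temperedFrobenioidR R S),
      Literature.AnabelianGeometry.EtaleTheta.Cor38_i (fun E _ => Literature.AlgebraicGeometry.Frobenioids.IsFrobeniusSlim E) h ∧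
        Literature.AnabelianGeometry.EtaleTheta.Cor38_ii
          (fun E _ Φ => ∀ (B : E) (α : Aut (Over.forget B)),
            (∀ (B' : Over B) (x : Φ.obj (op B'.left)),
              Literature.AlgebraicGeometry.Frobenioids.pull Φ (α.hom.app B') x = x) → α = 1) h ∧
        Cor38_iii h := by
  obtain ⟨h⟩ := TemperedFrobenioid.nonempty_cor38Hyp_ofRankOneObjectR rankOneObject hpf R S
  exact ⟨h, cor38_temperedFrobenioidR R S R S h⟩

/-- **[EtTh] Cor. 3.8 (ii) for every self-equivalence of the `Λ = ℝ` v2 model-of-record Frobenioid, NO binder.** [cite: MochizukiEtTh2009, Cor 3.8 p.81] -/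
theorem hull_selfEquivalence_temperedFrobenioidR
    (e : (TateTowerKummer.temperedFrobenioidR R S).category ≌ (TateTowerKummer.temperedFrobenioidR R S).category) :
    (∀ {X Y : (TateTowerKummer.temperedFrobenioidR R S).category} (f : X ⟶ Y),
        (TateTowerKummer.temperedFrobenioidR R S).IsBaseFieldTheoretic f ↔
          (TateTowerKummer.temperedFrobenioidR R S).IsBaseFieldTheoretic (e.functor.map f)) ∧
      ∃ e' : (TateTowerKummer.temperedFrobenioidR R S).hullCategory ≌ (TateTowerKummer.temperedFrobenioidR R S).hullCategory,
        Nonempty ((TateTowerKummer.temperedFrobenioidR R S).hull ⋙ e.functor ≅ e'.functor ⋙ (TateTowerKummer.temperedFrobenioidR R S).hull) :=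
  TemperedFrobenioid.hull_selfEquivalence_ofRankOneObjectR_ofTower rankOneObject hpf R S effRealSpan_ofTower prop34Const_ofTower e

end TateTowerKummer

end Literature.AnabelianGeometry.EtaleTheta

end
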